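import Literature.Analysis.FluidPDE.SteadyNavierStokesEnergy
import Literature.Analysis.FunctionSpaces.TorusFluidGlueProofs
import Literature.Analysis.FunctionSpaces.TorusCalculusProofs
import Summits.AnomalousDissipation.AnomalousDissipation.Theorems.TaylorCertificatesSteadyStatesLoudBoundedStubBadSeqZeroWork
import Summits.AnomalousDissipation.AnomalousDissipation.Theorems.TaylorCertificatesSteadyStatesLoudBoundedStubF123SmallEnergy
import HarnessLib

/-!
# Strong `L²` limits of bad sequences are quiet standing flows (tools lemma for
# `stub_f123NoOnsagerDodgerLevel3`, crux stmt-AnomalousDissipation-13038, line `lamb-floor-f123-shared-ceiling`)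

A BAD SEQUENCE of a smooth force `f` on `T³` is a sequence of admissible (smooth, divergence-free,
mean-zero) fields `u_n` with dual residual bounds `|∫⟪(u_n·∇)u_n − f, w⟫| ≤ R_n √(gradNormSq w)` against
every admissible test field `w`, `R_n → 0`, and vanishing virtual dissipation
`R_n √(gradNormSq u_n) → 0`.  The floor stub of the line asserts that bad sequences of the detuned
cyclic force below energy `3` have non-divergent enstrophy.  This file proves the rigorous core of the
"dodger dichotomy" used in the line's notes (`Lines/lamb-floor-f123-shared-ceiling-S1-c1.md` §P1): if a
bad sequence converges STRONGLY in `L²` to a field `v ∈ L²`, then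

* the work vanishes, `∫⟪f, v⟫ = 0` (`bad sequences do zero work`, landed `stub_badSeqZeroWork`, plus
  Cauchy–Schwarz), and
* `v` is a weak steady Euler flow of `f`: `∫⟪v, Dw·v⟫ + ∫⟪f, w⟫ = 0` for every admissible `w`
  (antisymmetry of the trilinear form on the smooth `u_n`, then `L²` convergence of the quadratic
  pairing, `|∫⟪u_n, Dw u_n⟫ − ∫⟪v, Dw v⟫| ≤ M(∫‖u_n−v‖² + 2√(∫‖v‖²)√(∫‖u_n−v‖²))`).

So every strongly convergent dodger produces a QUIET STANDING FLOW of `f` — the object any proof of the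
floor stub has to exclude, and the object the line's numerics search for.  Registered tools stub:
`stub_badSeqStrongLimit` (last theorem, verbatim).  Elementary; [folklore].
-/

noncomputable section

-- `Summit.<Summit>.<Problem>` is the tree's mandated summit-side namespace (CONVENTIONS §2); single-conjunct summit, duplicate deliberate.
set_option linter.dupNamespace false

open MeasureTheory Filter Topology

namespace Summit.AnomalousDissipation.AnomalousDissipation.Theorems.SteadyStatesLoudBounded.BadSeqStrongLimit

open Literature.Analysis.FunctionSpaces
open Summit.AnomalousDissipation.AnomalousDissipation.Theorems.SteadyStatesLoudBounded
open scoped InnerProductSpace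

/-! ## `L²` tools -/

/-- **Cauchy–Schwarz for pairings of `L²` fields**: `|∫ ⟪a, w⟫| ≤ √(∫ ‖a‖²) · √(∫ ‖w‖²)`
(adapted from `Literature.Analysis.FluidPDE.abs_integral_inner_le_sqrt_mul_sqrt`, kept private to keep
the import cone small). -/
private theorem abs_integral_inner_le_sqrt_mul_sqrt' {a w : (UnitAddTorus (Fin 3) → EuclideanSpace ℝ (Fin 3))} (ha : MemLp a 2 volume)
    (hw : MemLp w 2 volume) :
    |∫ x, ⟪a x, w x⟫_ℝ| ≤ Real.sqrt (∫ x, ‖a x‖ ^ 2) * Real.sqrt (∫ x, ‖w x‖ ^ 2) := by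
  have h1 : |∫ x, ⟪a x, w x⟫_ℝ| ≤ ∫ x, ‖a x‖ * ‖w x‖ := by
    rw [← Real.norm_eq_abs]
    refine (norm_integral_le_integral_norm _).trans (integral_mono_of_nonneg
      (ae_of_all _ fun x => norm_nonneg _) (ha.norm.integrable_mul hw.norm)
      (ae_of_all _ fun x => norm_inner_le_norm _ _))
  have h2 := integral_mul_le_Lp_mul_Lq_of_nonneg Real.HolderConjugate.two_two
    (ae_of_all _ fun x => norm_nonneg (a x)) (ae_of_all _ fun x => norm_nonneg (w x))
    (by simpa using ha.norm) (by simpa using hw.norm)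
  refine h1.trans (h2.trans_eq ?_)
  simp only [Real.rpow_two, one_div, Real.sqrt_eq_rpow]

/-- The pairing density of two `L²` fields is integrable. -/
private theorem integrable_inner' {a w : (UnitAddTorus (Fin 3) → EuclideanSpace ℝ (Fin 3))} (ha : MemLp a 2 volume) (hw : MemLp w 2 volume) :
    Integrable (fun x => ⟪a x, w x⟫_ℝ) volume :=
  Integrable.mono' (ha.norm.integrable_mul hw.norm) (ha.1.inner hw.1)
    (ae_of_all _ fun x => norm_inner_le_norm (a x) (w x))

/-- `x ↦ Dw(x) a(x)` is a.e. strongly measurable for smooth `w` and a.e. strongly measurable `a`. -/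
private theorem aestronglyMeasurable_fderiv_apply {w a : (UnitAddTorus (Fin 3) → EuclideanSpace ℝ (Fin 3))} (hw : Torus.IsSmooth w)
    (ha : AEStronglyMeasurable a volume) :
    AEStronglyMeasurable (fun x => Torus.fderiv w x (a x)) volume := by
  have hc : Continuous fun x => Torus.fderiv w x :=
    Literature.Analysis.FluidPDE.Torus.continuous_fderiv_of_isSmooth hw
  have hpair : AEStronglyMeasurable (fun x => (Torus.fderiv w x, a x)) volume :=
    hc.aestronglyMeasurable.prodMk ha
  exact (isBoundedBilinearMap_apply (𝕜 := ℝ) (E := EuclideanSpace ℝ (Fin 3))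
    (F := EuclideanSpace ℝ (Fin 3))).continuous.comp_aestronglyMeasurable hpair

/-- `x ↦ Dw(x) a(x)` is in `L²` when `a` is, with `∫‖Dw a‖² ≤ M² ∫‖a‖²` for a bound `M` of `‖Dw‖`. -/
private theorem memLp_fderiv_apply {w a : (UnitAddTorus (Fin 3) → EuclideanSpace ℝ (Fin 3))} (hw : Torus.IsSmooth w) {M : ℝ}
    (hM : ∀ x, ‖Torus.fderiv w x‖ ≤ M) (ha : MemLp a 2 volume) :
    MemLp (fun x => Torus.fderiv w x (a x)) 2 volume ∧
      ∫ x, ‖Torus.fderiv w x (a x)‖ ^ 2 ≤ M ^ 2 * ∫ x, ‖a x‖ ^ 2 := by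
  have hpt : ∀ x, ‖Torus.fderiv w x (a x)‖ ≤ M * ‖a x‖ := fun x =>
    ((Torus.fderiv w x).le_opNorm (a x)).trans (mul_le_mul_of_nonneg_right (hM x) (norm_nonneg _))
  have hmem : MemLp (fun x => Torus.fderiv w x (a x)) 2 volume :=
    MemLp.of_le_mul ha (aestronglyMeasurable_fderiv_apply hw ha.1) (ae_of_all _ hpt)
  refine ⟨hmem, ?_⟩
  have hia : Integrable (fun x => ‖a x‖ ^ 2) volume := (memLp_two_iff_integrable_sq_norm ha.1).1 ha
  rw [← integral_const_mul]
  refine integral_mono ((memLp_two_iff_integrable_sq_norm hmem.1).1 hmem) (hia.const_mul _) fun x => ?_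
  have h := hpt x
  have h0 : 0 ≤ ‖Torus.fderiv w x (a x)‖ := norm_nonneg _
  calc ‖Torus.fderiv w x (a x)‖ ^ 2 ≤ (M * ‖a x‖) ^ 2 := pow_le_pow_left₀ h0 h 2
    _ = M ^ 2 * ‖a x‖ ^ 2 := by ring

/-- `√(∫‖u_n − v‖²) → 0` from `∫‖u_n − v‖² → 0`. -/
private theorem tendsto_sqrt_of_tendsto {a : ℕ → ℝ} (h : Tendsto a atTop (𝓝 0)) :
    Tendsto (fun n => Real.sqrt (a n)) atTop (𝓝 0) := by
  have h2 : Tendsto (fun n => Real.sqrt (a n)) atTop (𝓝 (Real.sqrt 0)) :=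
    (Real.continuous_sqrt.tendsto 0).comp h
  rwa [Real.sqrt_zero] at h2

/-! ## Part (a): the work of the force on the limit vanishes -/

/-- **Pairings with a smooth field pass to the `L²` limit**: `∫⟪f, u_n⟫ → ∫⟪f, v⟫`. -/
theorem tendsto_integral_inner_of_L2 {f v : (UnitAddTorus (Fin 3) → EuclideanSpace ℝ (Fin 3))} {u : ℕ → (UnitAddTorus (Fin 3) → EuclideanSpace ℝ (Fin 3))} (hf : Torus.IsSmooth f)
    (hu : ∀ n, Torus.IsSmooth (u n)) (hv : MemLp v 2 volume)
    (hconv : Tendsto (fun n => ∫ x, ‖u n x - v x‖ ^ 2) atTop (𝓝 0)) :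
    Tendsto (fun n => ∫ x, ⟪f x, u n x⟫_ℝ) atTop (𝓝 (∫ x, ⟪f x, v x⟫_ℝ)) := by
  have hf2 : MemLp f 2 volume := hf.memLp 2
  have hg : ∀ n, MemLp (fun x => u n x - v x) 2 volume := fun n => ((hu n).memLp 2).sub hv
  -- `∫⟪f, u_n⟫ - ∫⟪f, v⟫ = ∫⟪f, u_n - v⟫`
  have hsplit : ∀ n, (∫ x, ⟪f x, u n x⟫_ℝ) - ∫ x, ⟪f x, v x⟫_ℝ = ∫ x, ⟪f x, u n x - v x⟫_ℝ := by
    intro n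
    rw [← integral_sub (integrable_inner' hf2 ((hu n).memLp 2)) (integrable_inner' hf2 hv)]
    exact integral_congr_ae (ae_of_all _ fun x => (inner_sub_right _ _ _).symm)
  have hbound : ∀ n, ‖(∫ x, ⟪f x, u n x⟫_ℝ) - ∫ x, ⟪f x, v x⟫_ℝ‖ ≤
      Real.sqrt (∫ x, ‖f x‖ ^ 2) * Real.sqrt (∫ x, ‖u n x - v x‖ ^ 2) := by
    intro n
    rw [hsplit n, Real.norm_eq_abs]
    exact abs_integral_inner_le_sqrt_mul_sqrt' hf2 (hg n)
  have hlim : Tendsto (fun n => Real.sqrt (∫ x, ‖f x‖ ^ 2) * Real.sqrt (∫ x, ‖u n x - v x‖ ^ 2))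
      atTop (𝓝 0) := by
    have := (tendsto_sqrt_of_tendsto hconv).const_mul (Real.sqrt (∫ x, ‖f x‖ ^ 2))
    simpa using this
  have h := squeeze_zero_norm hbound hlim
  have h2 := h.add_const (∫ x, ⟪f x, v x⟫_ℝ)
  simpa using h2

/-- **Strong `L²` limits of bad sequences do zero work**: `∫⟪f, v⟫ = 0`. -/
theorem integral_inner_limit_eq_zero {f v : (UnitAddTorus (Fin 3) → EuclideanSpace ℝ (Fin 3))} {u : ℕ → (UnitAddTorus (Fin 3) → EuclideanSpace ℝ (Fin 3))} {R : ℕ → ℝ} (hf : Torus.IsSmooth f)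
    (hseq : ∀ n : ℕ, Torus.IsSmooth (u n) ∧ Torus.IsDivFree (u n) ∧ Torus.HasZeroMean (u n) ∧
      ∀ w : (UnitAddTorus (Fin 3) → EuclideanSpace ℝ (Fin 3)), Torus.IsSmooth w → Torus.IsDivFree w → Torus.HasZeroMean w →
        |∫ x, ⟪Torus.convect (u n) (u n) x - f x, w x⟫_ℝ| ≤ R n * Real.sqrt (Torus.gradNormSq w))
    (hRD : Tendsto (fun n => R n * Real.sqrt (Torus.gradNormSq (u n))) atTop (𝓝 0))
    (hv : MemLp v 2 volume) (hconv : Tendsto (fun n => ∫ x, ‖u n x - v x‖ ^ 2) atTop (𝓝 0)) :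
    ∫ x, ⟪f x, v x⟫_ℝ = 0 := by
  have hwork : Tendsto (fun n => ∫ x, ⟪f x, u n x⟫_ℝ) atTop (𝓝 0) :=
    BadSeqZeroWork.stub_badSeqZeroWork f u R hf hseq hRD
  have hlim := tendsto_integral_inner_of_L2 hf (fun n => (hseq n).1) hv hconv
  exact tendsto_nhds_unique hlim hwork

/-! ## Part (b): the limit is a weak steady Euler flow -/

/-- **The quadratic pairing passes to the `L²` limit**: `∫⟪u_n, Dw u_n⟫ → ∫⟪v, Dw v⟫` for smooth `w`. -/
theorem tendsto_integral_inner_fderiv_apply {v : (UnitAddTorus (Fin 3) → EuclideanSpace ℝ (Fin 3))} {u : ℕ → (UnitAddTorus (Fin 3) → EuclideanSpace ℝ (Fin 3))} {w : (UnitAddTorus (Fin 3) → EuclideanSpace ℝ (Fin 3))} (hw : Torus.IsSmooth w)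
    (hu : ∀ n, Torus.IsSmooth (u n)) (hv : MemLp v 2 volume)
    (hconv : Tendsto (fun n => ∫ x, ‖u n x - v x‖ ^ 2) atTop (𝓝 0)) :
    Tendsto (fun n => ∫ x, ⟪u n x, Torus.fderiv w x (u n x)⟫_ℝ) atTop
      (𝓝 (∫ x, ⟪v x, Torus.fderiv w x (v x)⟫_ℝ)) := by
  obtain ⟨M, hM0, hM⟩ := F123SmallEnergy.exists_bound_fderiv' hw
  set g : ℕ → (UnitAddTorus (Fin 3) → EuclideanSpace ℝ (Fin 3)) := fun n x => u n x - v x with hgdef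
  have hu2 : ∀ n, MemLp (u n) 2 volume := fun n => (hu n).memLp 2
  have hg : ∀ n, MemLp (g n) 2 volume := fun n => (hu2 n).sub hv
  have hDv := memLp_fderiv_apply hw hM hv
  have hDg : ∀ n, MemLp (fun x => Torus.fderiv w x (g n x)) 2 volume ∧
      ∫ x, ‖Torus.fderiv w x (g n x)‖ ^ 2 ≤ M ^ 2 * ∫ x, ‖g n x‖ ^ 2 := fun n =>
    memLp_fderiv_apply hw hM (hg n)
  -- pointwise three-term splitting
  have hpt : ∀ n x, ⟪u n x, Torus.fderiv w x (u n x)⟫_ℝ - ⟪v x, Torus.fderiv w x (v x)⟫_ℝ =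
      ⟪g n x, Torus.fderiv w x (g n x)⟫_ℝ + ⟪g n x, Torus.fderiv w x (v x)⟫_ℝ +
        ⟪v x, Torus.fderiv w x (g n x)⟫_ℝ := by
    intro n x
    have hu_eq : u n x = g n x + v x := by simp [hgdef]
    rw [hu_eq, map_add, inner_add_left, inner_add_right, inner_add_right]
    ring
  -- integrability of every term
  have i_uu : ∀ n, Integrable (fun x => ⟪u n x, Torus.fderiv w x (u n x)⟫_ℝ) volume := fun n =>
    integrable_inner' (hu2 n) (memLp_fderiv_apply hw hM (hu2 n)).1
  have i_vv : Integrable (fun x => ⟪v x, Torus.fderiv w x (v x)⟫_ℝ) volume := integrable_inner' hv hDv.1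
  have i_gg : ∀ n, Integrable (fun x => ⟪g n x, Torus.fderiv w x (g n x)⟫_ℝ) volume := fun n =>
    integrable_inner' (hg n) (hDg n).1
  have i_gv : ∀ n, Integrable (fun x => ⟪g n x, Torus.fderiv w x (v x)⟫_ℝ) volume := fun n =>
    integrable_inner' (hg n) hDv.1
  have i_vg : ∀ n, Integrable (fun x => ⟪v x, Torus.fderiv w x (g n x)⟫_ℝ) volume := fun n =>
    integrable_inner' hv (hDg n).1
  -- the difference of the pairings, split
  have hdiff : ∀ n, (∫ x, ⟪u n x, Torus.fderiv w x (u n x)⟫_ℝ) - ∫ x, ⟪v x, Torus.fderiv w x (v x)⟫_ℝ =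
      (∫ x, ⟪g n x, Torus.fderiv w x (g n x)⟫_ℝ) + (∫ x, ⟪g n x, Torus.fderiv w x (v x)⟫_ℝ) +
        ∫ x, ⟪v x, Torus.fderiv w x (g n x)⟫_ℝ := by
    intro n
    have i12 : Integrable (fun x => ⟪g n x, Torus.fderiv w x (g n x)⟫_ℝ + ⟪g n x, Torus.fderiv w x (v x)⟫_ℝ)
        volume := (i_gg n).add (i_gv n)
    have e1 : ∫ x, (⟪u n x, Torus.fderiv w x (u n x)⟫_ℝ - ⟪v x, Torus.fderiv w x (v x)⟫_ℝ) =
        ∫ x, (⟪g n x, Torus.fderiv w x (g n x)⟫_ℝ + ⟪g n x, Torus.fderiv w x (v x)⟫_ℝ +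
          ⟪v x, Torus.fderiv w x (g n x)⟫_ℝ) := integral_congr_ae (ae_of_all _ fun x => hpt n x)
    rw [integral_sub (i_uu n) i_vv, integral_add i12 (i_vg n), integral_add (i_gg n) (i_gv n)] at e1
    exact e1
  -- bounds on the three terms
  have b1 : ∀ n, |∫ x, ⟪g n x, Torus.fderiv w x (g n x)⟫_ℝ| ≤ M * ∫ x, ‖g n x‖ ^ 2 := by
    intro n
    rw [← Real.norm_eq_abs, ← integral_const_mul]
    refine norm_integral_le_of_norm_le (((memLp_two_iff_integrable_sq_norm (hg n).1).1 (hg n)).const_mul M)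
      (ae_of_all _ fun x => ?_)
    calc ‖⟪g n x, Torus.fderiv w x (g n x)⟫_ℝ‖ ≤ ‖g n x‖ * ‖Torus.fderiv w x (g n x)‖ := norm_inner_le_norm _ _
      _ ≤ ‖g n x‖ * (M * ‖g n x‖) := by
          refine mul_le_mul_of_nonneg_left ?_ (norm_nonneg _)
          exact ((Torus.fderiv w x).le_opNorm _).trans (mul_le_mul_of_nonneg_right (hM x) (norm_nonneg _))
      _ = M * ‖g n x‖ ^ 2 := by ring
  have hsqrtM : ∀ {a : (UnitAddTorus (Fin 3) → EuclideanSpace ℝ (Fin 3))}, MemLp a 2 volume →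
      Real.sqrt (∫ x, ‖Torus.fderiv w x (a x)‖ ^ 2) ≤ M * Real.sqrt (∫ x, ‖a x‖ ^ 2) := by
    intro a ha
    have h := (memLp_fderiv_apply hw hM ha).2
    calc Real.sqrt (∫ x, ‖Torus.fderiv w x (a x)‖ ^ 2) ≤ Real.sqrt (M ^ 2 * ∫ x, ‖a x‖ ^ 2) :=
          Real.sqrt_le_sqrt h
      _ = M * Real.sqrt (∫ x, ‖a x‖ ^ 2) := by
          rw [Real.sqrt_mul (sq_nonneg M), Real.sqrt_sq hM0]
  have b2 : ∀ n, |∫ x, ⟪g n x, Torus.fderiv w x (v x)⟫_ℝ| ≤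
      Real.sqrt (∫ x, ‖g n x‖ ^ 2) * (M * Real.sqrt (∫ x, ‖v x‖ ^ 2)) := fun n =>
    (abs_integral_inner_le_sqrt_mul_sqrt' (hg n) hDv.1).trans
      (mul_le_mul_of_nonneg_left (hsqrtM hv) (Real.sqrt_nonneg _))
  have b3 : ∀ n, |∫ x, ⟪v x, Torus.fderiv w x (g n x)⟫_ℝ| ≤
      Real.sqrt (∫ x, ‖v x‖ ^ 2) * (M * Real.sqrt (∫ x, ‖g n x‖ ^ 2)) := fun n =>
    (abs_integral_inner_le_sqrt_mul_sqrt' hv (hDg n).1).trans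
      (mul_le_mul_of_nonneg_left (hsqrtM (hg n)) (Real.sqrt_nonneg _))
  -- assemble
  set b : ℕ → ℝ := fun n => M * (∫ x, ‖g n x‖ ^ 2) +
    Real.sqrt (∫ x, ‖g n x‖ ^ 2) * (M * Real.sqrt (∫ x, ‖v x‖ ^ 2)) +
    Real.sqrt (∫ x, ‖v x‖ ^ 2) * (M * Real.sqrt (∫ x, ‖g n x‖ ^ 2)) with hbdef
  have hbound : ∀ n, ‖(∫ x, ⟪u n x, Torus.fderiv w x (u n x)⟫_ℝ) - ∫ x, ⟪v x, Torus.fderiv w x (v x)⟫_ℝ‖ ≤ b n := by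
    intro n
    rw [hdiff n, Real.norm_eq_abs]
    refine (abs_add_le _ _).trans (add_le_add ((abs_add_le _ _).trans (add_le_add (b1 n) (b2 n))) (b3 n))
  have hconv' : Tendsto (fun n => ∫ x, ‖g n x‖ ^ 2) atTop (𝓝 0) := by simpa [hgdef] using hconv
  have hsq := tendsto_sqrt_of_tendsto hconv'
  have hb : Tendsto b atTop (𝓝 0) := by
    have t1 := hconv'.const_mul M
    have t2 := hsq.mul_const (M * Real.sqrt (∫ x, ‖v x‖ ^ 2))
    have t3 := (hsq.const_mul M).const_mul (Real.sqrt (∫ x, ‖v x‖ ^ 2))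
    have := (t1.add t2).add t3
    simpa [hbdef] using this
  have h := squeeze_zero_norm hbound hb
  have h2 := h.add_const (∫ x, ⟪v x, Torus.fderiv w x (v x)⟫_ℝ)
  simpa using h2

/-- **Registered tools stub `stub_badSeqStrongLimit`: strong `L²` limits of bad sequences are quiet
standing flows.** For a smooth force `f`, a bad sequence `u_n` (admissible, dual residual bounds `R_n`,
`R_n → 0`, `R_n √(gradNormSq u_n) → 0`) and `v ∈ L²` with `∫‖u_n − v‖² → 0`: the work vanishes,
`∫⟪f, v⟫ = 0`, and `v` is a weak steady Euler flow of `f`, `∫⟪v, Dw·v⟫ + ∫⟪f, w⟫ = 0` for every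
admissible test field `w`. -/
theorem stub_badSeqStrongLimit : ∀ (f v : UnitAddTorus (Fin 3) → EuclideanSpace ℝ (Fin 3)) (u : ℕ → UnitAddTorus (Fin 3) → EuclideanSpace ℝ (Fin 3)) (R : ℕ → ℝ), Torus.IsSmooth f → (∀ n : ℕ, Torus.IsSmooth (u n) ∧ Torus.IsDivFree (u n) ∧ Torus.HasZeroMean (u n) ∧ 0 ≤ R n ∧ ∀ w : UnitAddTorus (Fin 3) → EuclideanSpace ℝ (Fin 3), Torus.IsSmooth w → Torus.IsDivFree w → Torus.HasZeroMean w → |∫ x, inner ℝ (Torus.convect (u n) (u n) x - f x) (w x)| ≤ R n * Real.sqrt (Torus.gradNormSq w)) → Filter.Tendsto R Filter.atTop (nhds 0) → Filter.Tendsto (fun n => R n * Real.sqrt (Torus.gradNormSq (u n))) Filter.atTop (nhds 0) → MeasureTheory.MemLp v 2 MeasureTheory.volume → Filter.Tendsto (fun n => ∫ x, ‖u n x - v x‖ ^ 2) Filter.atTop (nhds 0) → (∫ x, inner ℝ (f x) (v x) = 0) ∧ ∀ w : UnitAddTorus (Fin 3) → EuclideanSpace ℝ (Fin 3), Torus.IsSmooth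 w → Torus.IsDivFree w → Torus.HasZeroMean w → (∫ x, inner ℝ (v x) (Torus.fderiv w x (v x))) + ∫ x, inner ℝ (f x) (w x) = 0 := by
  intro f v u R hf hseq hR hRD hv hconv
  have hseq' : ∀ n : ℕ, Torus.IsSmooth (u n) ∧ Torus.IsDivFree (u n) ∧ Torus.HasZeroMean (u n) ∧
      ∀ w : (UnitAddTorus (Fin 3) → EuclideanSpace ℝ (Fin 3)), Torus.IsSmooth w → Torus.IsDivFree w → Torus.HasZeroMean w →
        |∫ x, ⟪Torus.convect (u n) (u n) x - f x, w x⟫_ℝ| ≤ R n * Real.sqrt (Torus.gradNormSq w) :=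
    fun n => ⟨(hseq n).1, (hseq n).2.1, (hseq n).2.2.1, (hseq n).2.2.2.2⟩
  refine ⟨integral_inner_limit_eq_zero hf hseq' hRD hv hconv, fun w hws hwd hwz => ?_⟩
  have hu : ∀ n, Torus.IsSmooth (u n) := fun n => (hseq n).1
  -- the residual bound, rewritten through the antisymmetry of the trilinear form on the smooth `u n`
  have hQ : ∀ n, |(∫ x, ⟪u n x, Torus.fderiv w x (u n x)⟫_ℝ) + ∫ x, ⟪f x, w x⟫_ℝ| ≤
      R n * Real.sqrt (Torus.gradNormSq w) := by
    intro n
    have hres := (hseq n).2.2.2.2 w hws hwd hwz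
    have i1 : Integrable (fun x => ⟪Torus.convect (u n) (u n) x, w x⟫_ℝ) volume :=
      (((hu n).convect (hu n)).inner hws).integrable
    have i2 : Integrable (fun x => ⟪f x, w x⟫_ℝ) volume := (hf.inner hws).integrable
    have hsplit : ∫ x, ⟪Torus.convect (u n) (u n) x - f x, w x⟫_ℝ =
        (∫ x, ⟪Torus.convect (u n) (u n) x, w x⟫_ℝ) - ∫ x, ⟪f x, w x⟫_ℝ := by
      rw [← integral_sub i1 i2]
      exact integral_congr_ae (ae_of_all _ fun x => inner_sub_left _ _ _)
    have hanti : ∫ x, ⟪Torus.convect (u n) (u n) x, w x⟫_ℝ = -∫ x, ⟪u n x, Torus.fderiv w x (u n x)⟫_ℝ :=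
      Torus.integral_inner_convect_eq_neg (hu n) (hseq n).2.1 (hu n) hws
    rw [hsplit, hanti] at hres
    have : -(∫ x, ⟪u n x, Torus.fderiv w x (u n x)⟫_ℝ) - ∫ x, ⟪f x, w x⟫_ℝ =
        -((∫ x, ⟪u n x, Torus.fderiv w x (u n x)⟫_ℝ) + ∫ x, ⟪f x, w x⟫_ℝ) := by ring
    rw [this, abs_neg] at hres
    exact hres
  have hR0 : Tendsto (fun n => R n * Real.sqrt (Torus.gradNormSq w)) atTop (𝓝 0) := by
    simpa using hR.mul_const (Real.sqrt (Torus.gradNormSq w))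
  have hzero : Tendsto (fun n => (∫ x, ⟪u n x, Torus.fderiv w x (u n x)⟫_ℝ) + ∫ x, ⟪f x, w x⟫_ℝ)
      atTop (𝓝 0) :=
    squeeze_zero_norm (fun n => by rw [Real.norm_eq_abs]; exact hQ n) hR0
  have hlim : Tendsto (fun n => (∫ x, ⟪u n x, Torus.fderiv w x (u n x)⟫_ℝ) + ∫ x, ⟪f x, w x⟫_ℝ)
      atTop (𝓝 ((∫ x, ⟪v x, Torus.fderiv w x (v x)⟫_ℝ) + ∫ x, ⟪f x, w x⟫_ℝ)) :=
    (tendsto_integral_inner_fderiv_apply hws hu hv hconv).add_const _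
  exact tendsto_nhds_unique hlim hzero

end Summit.AnomalousDissipation.AnomalousDissipation.Theorems.SteadyStatesLoudBounded.BadSeqStrongLimit

end
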